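import Summits.PneNP.PneNP.Theorems.ConvexRankGatesConvexGateBlindOneGate
import Summits.PneNP.PneNP.Theorems.ConvexRankGatesCaptureDualLP
import Summits.PneNP.PneNP.Theorems.ConvexRankGatesLinAlgGateBlindKonigDuality
import HarnessLib

/-!
# Hall-cover gates are CONV gates: the Hall-cover re-typing of crux `LinAlgGateBlind` is subsumed by crux `ConvexGateBlind`

Support file for crux `LinAlgGateBlind` (stmt-PneNP-10681) of route `PneNP/ConvexRankGates` (`--supports`; closes
nothing). Four line leads (`Cruxes/LinAlgGateBlind/PICKED.md`) recommend re-typing the GRANK half of the crux as the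
cancellation-free HALL-COVER layer ("reject iff a vertex cover `(A, W)` with `#A + #W < θ` covers the OR-pattern
`P₀ ∪ ⋃_{vᵢ = 1} Pᵢ ⊆ [d]²`", the class of the split child `SGHallCover`, `Cruxes/LinAlgGateBlind/Split.lean`).
This file computes where that re-typing lands inside the route:

* `isConvGate_of_coverGate` — every Hall-cover gate of dimension `d` is ONE CONV gate of width `2d² + 2d + 1`: by
  Kőnig–Egerváry (`exists_matching_iff_forall_cover`, landed) the gate accepts `v` iff the pattern carries a
  `θ`-matching, iff the FRACTIONAL matching system `{y ≥ 0 : row/column sums ≤ 1, y_t ≤ [t ∈ P₀] + Σᵢ [t ∈ Pᵢ]·[vᵢ],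
  Σ_t y_t ≥ θ}` is feasible (weak duality `sum_le_card_add_card_of_cover` replaces total unimodularity) — an
  LP-feasibility gate with non-negative input coefficients on the right-hand sides, i.e. a max-right weak MLP gate
  (Oliveira–Pudlák 2019, Def. 3.1; Thm 5.2 for perfect matching), hence CONV with a diagonal matrix variable
  (`isConvGate_of_lp`, landed in `ConvexRankGatesCaptureDualLP`).
* `hallCoverCircuitBlind_of_convexGateBlind` — hence crux #2 `ConvexGateBlind` (stmt-PneNP-10680) IMPLIES the
  Hall-cover re-typing of the GRANK half of crux #4: no polynomial-size `{∧₂, ∨₂} ∪ HALLCOVER_{m^c}` circuit computes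
  `CLIQUE(m, ⌈m^δ⌉₊)` (same `δ`; exponent `c ↦ 2c + 3`).
* `oneCoverGate_blind_of_convexGateBlind` — and the single-gate floor of the child `SGHallCover`
  (`sgHallCover_forces_oneCoverGate_blind`, `…SGHallCoverCalibration.lean`, there at `k = ⌈m^{1/8}⌉₊`) follows from
  `ConvexGateBlind` at its own `δ` (`convexGateBlind_iff_oneGate`, landed).

Reading for the planner (D-0014): re-typing GRANK ↦ Hall-cover does not create a new crux — that half is a corollary
of crux #2, whose LP slice is Oliveira–Pudlák's open Problem (1) (ToCT 2019 §8; Krajíček 2019 §18.8); with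
`isGRankGate_of_matchingGate` (`…KonigIsGRank.lean`) the Hall-cover layer sits in CONV ∩ GRANK; a re-typed crux #4
adds to crux #2 only its PERM half. Sources: Kőnig 1931 / Egerváry 1931; Oliveira–Pudlák 2019, Def. 3.1, Thm 5.2,
§8 Problem (1). [folklore]
-/

-- `Summit.PneNP.PneNP.…` duplicates `PneNP` BY DESIGN (single-problem summit).
set_option linter.dupNamespace false

noncomputable section

namespace Summit.PneNP.PneNP.Theorems

open Finset Filter Literature.Computability.Complexity
open Summit.PneNP.PneNP.Theorems.Capture.DualityAudit (isConvGate_of_lp)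

/-! ### The fractional matching system of a pattern -/

section LP

variable {d : ℕ}

/-- Row sums of a function on `[d] × [d]`, as a sum over all cells. [folklore] -/
theorem sum_ite_fst_eq (y : Fin d × Fin d → ℝ) (a : Fin d) :
    ∑ j : Fin d × Fin d, (if j.1 = a then y j else 0) = ∑ w, y (a, w) := by
  rw [Fintype.sum_prod_type, Finset.sum_eq_single a] <;> simp +contextual

/-- Column sums of a function on `[d] × [d]`, as a sum over all cells. [folklore] -/
theorem sum_ite_snd_eq (y : Fin d × Fin d → ℝ) (w : Fin d) :
    ∑ j : Fin d × Fin d, (if j.2 = w then y j else 0) = ∑ a, y (a, w) := by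
  rw [Fintype.sum_prod_type_right, Finset.sum_eq_single w] <;> simp +contextual

/-- **Weak duality for fractional bipartite matchings**: a non-negative `y` on `[d]²` with row and column sums
`≤ 1`, supported on a pattern `S` covered by rows `A` and columns `W`, has total mass `≤ #A + #W`. [folklore] -/
theorem sum_le_card_add_card_of_cover (S : Set (Fin d × Fin d)) (y : Fin d × Fin d → ℝ)
    (hy0 : ∀ j, 0 ≤ y j) (hrow : ∀ a, ∑ w, y (a, w) ≤ 1) (hcol : ∀ w, ∑ a, y (a, w) ≤ 1)
    (hsupp : ∀ j, j ∉ S → y j = 0) (A W : Finset (Fin d)) (hcov : ∀ j ∈ S, j.1 ∈ A ∨ j.2 ∈ W) :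
    ∑ j, y j ≤ A.card + W.card := by
  classical
  have h1 : ∀ j, y j ≤ (if j.1 ∈ A then y j else 0) + (if j.2 ∈ W then y j else 0) := by
    intro j
    have hj0 := hy0 j
    by_cases hj : j ∈ S
    · rcases hcov j hj with h | h
      · rw [if_pos h]
        split_ifs <;> linarith
      · rw [if_pos h]
        split_ifs <;> linarith
    · rw [hsupp j hj]
      simp
  have hA : ∑ j : Fin d × Fin d, (if j.1 ∈ A then y j else 0) ≤ A.card := by
    rw [Fintype.sum_prod_type]
    calc ∑ a, ∑ w, (if ((a, w) : Fin d × Fin d).1 ∈ A then y (a, w) else 0)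
        = ∑ a, (if a ∈ A then ∑ w, y (a, w) else 0) := by
          refine Finset.sum_congr rfl fun a _ => ?_
          split_ifs <;> simp
      _ = ∑ a ∈ A, ∑ w, y (a, w) := by
          rw [Finset.sum_ite_mem, Finset.univ_inter]
      _ ≤ ∑ a ∈ A, (1 : ℝ) := Finset.sum_le_sum fun a _ => hrow a
      _ = A.card := by simp
  have hW : ∑ j : Fin d × Fin d, (if j.2 ∈ W then y j else 0) ≤ W.card := by
    rw [Fintype.sum_prod_type_right]
    calc ∑ w, ∑ a, (if ((a, w) : Fin d × Fin d).2 ∈ W then y (a, w) else 0)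
        = ∑ w, (if w ∈ W then ∑ a, y (a, w) else 0) := by
          refine Finset.sum_congr rfl fun w _ => ?_
          split_ifs <;> simp
      _ = ∑ w ∈ W, ∑ a, y (a, w) := by
          rw [Finset.sum_ite_mem, Finset.univ_inter]
      _ ≤ ∑ w ∈ W, (1 : ℝ) := Finset.sum_le_sum fun w _ => hcol w
      _ = W.card := by simp
  calc ∑ j, y j ≤ ∑ j, ((if j.1 ∈ A then y j else 0) + (if j.2 ∈ W then y j else 0)) :=
        Finset.sum_le_sum fun j _ => h1 j
    _ = ∑ j, (if j.1 ∈ A then y j else 0) + ∑ j, (if j.2 ∈ W then y j else 0) := Finset.sum_add_distrib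
    _ ≤ A.card + W.card := add_le_add hA hW

/-- **A `θ`-matching inside a pattern is a feasible point of the fractional matching system** (its indicator:
non-negative, `≤ 1`, row and column sums `≤ 1`, supported on the pattern, total mass `θ`). [folklore] -/
theorem exists_fractional_of_matching (S : Set (Fin d × Fin d)) {θ : ℕ} (r s : Fin θ → Fin d)
    (hr : Function.Injective r) (hs : Function.Injective s) (hrs : ∀ j, (r j, s j) ∈ S) :
    ∃ y : Fin d × Fin d → ℝ, (∀ j, 0 ≤ y j) ∧ (∀ a, ∑ w, y (a, w) ≤ 1) ∧ (∀ w, ∑ a, y (a, w) ≤ 1) ∧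
      (∀ j, j ∉ S → y j = 0) ∧ (∀ j, y j ≤ 1) ∧ (θ : ℝ) ≤ ∑ j, y j := by
  classical
  let M : Finset (Fin d × Fin d) := univ.image fun j => (r j, s j)
  have hinj : Function.Injective fun j => (r j, s j) := fun j j' h => hr (Prod.mk.inj h).1
  have hM : M.card = θ := by
    rw [Finset.card_image_of_injective _ hinj]
    simp
  have hmem : ∀ t, t ∈ M ↔ ∃ j, (r j, s j) = t := fun t => by simp [M]
  refine ⟨fun t => if t ∈ M then 1 else 0, fun t => ?_, fun a => ?_, fun w => ?_, fun t ht => ?_,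
    fun t => ?_, ?_⟩
  · show (0 : ℝ) ≤ (if t ∈ M then 1 else 0)
    split_ifs <;> norm_num
  · -- row `a`: at most one cell of `M`, since `r` is injective
    rw [Finset.sum_boole]
    have hle : (univ.filter fun w => (a, w) ∈ M).card ≤ 1 := by
      refine Finset.card_le_one.2 fun w₁ hw₁ w₂ hw₂ => ?_
      simp only [Finset.mem_filter, Finset.mem_univ, true_and, hmem] at hw₁ hw₂
      obtain ⟨j₁, hj₁⟩ := hw₁
      obtain ⟨j₂, hj₂⟩ := hw₂
      obtain ⟨h₁r, h₁s⟩ := Prod.mk.inj hj₁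
      obtain ⟨h₂r, h₂s⟩ := Prod.mk.inj hj₂
      have : j₁ = j₂ := hr (h₁r.trans h₂r.symm)
      subst this
      exact h₁s.symm.trans h₂s
    exact_mod_cast hle
  · -- column `w`: at most one cell of `M`, since `s` is injective
    rw [Finset.sum_boole]
    have hle : (univ.filter fun a => (a, w) ∈ M).card ≤ 1 := by
      refine Finset.card_le_one.2 fun a₁ ha₁ a₂ ha₂ => ?_
      simp only [Finset.mem_filter, Finset.mem_univ, true_and, hmem] at ha₁ ha₂
      obtain ⟨j₁, hj₁⟩ := ha₁
      obtain ⟨j₂, hj₂⟩ := ha₂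
      obtain ⟨h₁r, h₁s⟩ := Prod.mk.inj hj₁
      obtain ⟨h₂r, h₂s⟩ := Prod.mk.inj hj₂
      have : j₁ = j₂ := hs (h₁s.trans h₂s.symm)
      subst this
      exact h₁r.symm.trans h₂r
    exact_mod_cast hle
  · -- support
    show (if t ∈ M then (1 : ℝ) else 0) = 0
    rw [if_neg]
    intro htM
    obtain ⟨j, hj⟩ := (hmem t).1 htM
    exact ht (hj ▸ hrs j)
  · show (if t ∈ M then (1 : ℝ) else 0) ≤ 1
    split_ifs <;> norm_num
  · -- total mass `= #M = θ`
    rw [Finset.sum_boole, Finset.filter_mem_eq_inter, Finset.univ_inter, hM]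

end LP

/-! ### Hall-cover gates are CONV gates -/

/-- **Every Hall-cover gate is one CONV gate.** If `f v = 0` iff some vertex cover `(A, W)` with `#A + #W < θ`
covers the OR-pattern `{x ∈ P₀} ∪ {x | ∃ i, vᵢ = 1 ∧ x ∈ Pᵢ} ⊆ [d]²` (the class of the split child `SGHallCover`,
verbatim), then `f` is a CONV gate of width `2d² + 2d + 1`: LP feasibility of the fractional matching system of the
pattern (`d²` variables; `2d` degree rows, `d²` activity rows, one threshold row), by Kőnig–Egerváry and weak duality;
a max-right weak MLP gate (Oliveira–Pudlák 2019, Def. 3.1), CONV by `isConvGate_of_lp`. [folklore] -/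
theorem isConvGate_of_coverGate : ∀ {n d θ : ℕ} (P₀ : Set (Fin d × Fin d)) (P : Fin n → Set (Fin d × Fin d))
    (f : (Fin n → Bool) → Bool),
    (∀ v, f v = false ↔ ∃ A W : Finset (Fin d), A.card + W.card < θ ∧
      ∀ x ∈ {x : Fin d × Fin d | x ∈ P₀ ∨ ∃ i, v i = true ∧ x ∈ P i}, x.1 ∈ A ∨ x.2 ∈ W) →
    IsConvGate (2 * d ^ 2 + 2 * d + 1) ⟨n, f⟩ := by
  intro n d θ P₀ P f hf
  classical
  -- the activity of a cell at the input `v`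
  let act : (Fin n → Bool) → Fin d × Fin d → ℝ := fun v t =>
    (if t ∈ P₀ then (1 : ℝ) else 0) + ∑ i, (if t ∈ P i then (1 : ℝ) else 0) * (if v i then (1 : ℝ) else 0)
  have hact0 : ∀ v t, t ∉ {x : Fin d × Fin d | x ∈ P₀ ∨ ∃ i, v i = true ∧ x ∈ P i} → act v t = 0 := by
    intro v t ht
    simp only [Set.mem_setOf_eq, not_or, not_exists, not_and] at ht
    obtain ⟨ht0, ht1⟩ := ht
    simp only [act, if_neg ht0, zero_add]
    refine Finset.sum_eq_zero fun i _ => ?_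
    by_cases hti : t ∈ P i
    · have hvi : v i = false := by
        cases hv : v i with
        | false => rfl
        | true => exact absurd hti (ht1 i hv)
      simp [hti, hvi]
    · simp [hti]
  have hact1 : ∀ v t, t ∈ {x : Fin d × Fin d | x ∈ P₀ ∨ ∃ i, v i = true ∧ x ∈ P i} → 1 ≤ act v t := by
    intro v t ht
    have hterm : ∀ i, 0 ≤ (if t ∈ P i then (1 : ℝ) else 0) * (if v i then (1 : ℝ) else 0) := fun i =>
      mul_nonneg (by split_ifs <;> norm_num) (by split_ifs <;> norm_num)
    have hsum : 0 ≤ ∑ i, (if t ∈ P i then (1 : ℝ) else 0) * (if v i then (1 : ℝ) else 0) :=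
      Finset.sum_nonneg fun i _ => hterm i
    rcases ht with ht0 | ⟨i, hvi, hti⟩
    · simp only [act, if_pos ht0]
      linarith
    · have hi : (1 : ℝ) ≤ ∑ i, (if t ∈ P i then (1 : ℝ) else 0) * (if v i then (1 : ℝ) else 0) := by
        have h := Finset.single_le_sum (fun i _ => hterm i) (Finset.mem_univ i)
        simp only [hti, hvi, if_true, mul_one] at h
        exact h
      have h0 : 0 ≤ (if t ∈ P₀ then (1 : ℝ) else 0) := by split_ifs <;> norm_num
      simp only [act]
      linarith
  -- semantic step: `f v = 1` iff the fractional matching system of the pattern at `v` is feasible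
  have hsem : ∀ v, f v = true ↔ ∃ y : Fin d × Fin d → ℝ, (∀ j, 0 ≤ y j) ∧ (∀ a, ∑ w, y (a, w) ≤ 1) ∧
      (∀ w, ∑ a, y (a, w) ≤ 1) ∧ (∀ t, y t ≤ act v t) ∧ (θ : ℝ) ≤ ∑ j, y j := by
    intro v
    set S : Set (Fin d × Fin d) := {x : Fin d × Fin d | x ∈ P₀ ∨ ∃ i, v i = true ∧ x ∈ P i} with hS
    have hK := exists_matching_iff_forall_cover (fun a b : Fin d => (a, b) ∈ S) θ
    constructor
    · intro hv
      have hcov : ∀ (A W : Finset (Fin d)), (∀ a b, (a, b) ∈ S → a ∈ A ∨ b ∈ W) →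
          θ ≤ A.card + W.card := by
        intro A W hAW
        by_contra hlt
        have hfalse : f v = false := (hf v).2 ⟨A, W, by omega, fun x hx => hAW x.1 x.2 hx⟩
        rw [hv] at hfalse
        exact Bool.noConfusion hfalse
      obtain ⟨r, s, hr, hs, hrs⟩ := hK.2 hcov
      obtain ⟨y, hy0, hrow, hcol, hsupp, hy1, hθ⟩ := exists_fractional_of_matching S r s hr hs hrs
      refine ⟨y, hy0, hrow, hcol, fun t => ?_, hθ⟩
      by_cases ht : t ∈ S
      · exact (hy1 t).trans (hact1 v t ht)
      · rw [hsupp t ht]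
        exact (hact0 v t ht).ge
    · rintro ⟨y, hy0, hrow, hcol, hle, hθ⟩
      cases hfv : f v with
      | true => rfl
      | false =>
        exfalso
        obtain ⟨A, W, hlt, hAW⟩ := (hf v).1 hfv
        have hsupp : ∀ j, j ∉ S → y j = 0 := fun j hj =>
          le_antisymm ((hle j).trans (hact0 v j hj).le) (hy0 j)
        have h1 := sum_le_card_add_card_of_cover S y hy0 hrow hcol hsupp A W fun j hj => hAW j hj
        have h2 : (θ : ℝ) ≤ A.card + W.card := hθ.trans h1
        have h3 : θ ≤ A.card + W.card := by exact_mod_cast h2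
        omega
  -- syntactic step: the same system in the matrix form of `isConvGate_of_lp`
  let A : (Fin d ⊕ Fin d) ⊕ ((Fin d × Fin d) ⊕ Unit) → (Fin d × Fin d) → ℝ :=
    Sum.elim (Sum.elim (fun a j => if j.1 = a then 1 else 0) (fun w j => if j.2 = w then 1 else 0))
      (Sum.elim (fun t j => if j = t then 1 else 0) (fun _ _ => -1))
  let b : (Fin d ⊕ Fin d) ⊕ ((Fin d × Fin d) ⊕ Unit) → ℝ :=
    Sum.elim (fun _ => 1) (Sum.elim (fun t => if t ∈ P₀ then 1 else 0) (fun _ => -(θ : ℝ)))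
  let B : (Fin d ⊕ Fin d) ⊕ ((Fin d × Fin d) ⊕ Unit) → Fin n → ℝ :=
    Sum.elim (fun _ _ => 0) (Sum.elim (fun t k => if t ∈ P k then 1 else 0) (fun _ _ => 0))
  have hB : ∀ i k, 0 ≤ B i k := by
    have h01 : ∀ (p : Prop) [Decidable p], (0 : ℝ) ≤ (if p then 1 else 0) := fun p _ => by
      split_ifs <;> norm_num
    rintro ((a | w) | (t | u)) k <;> first | exact le_rfl | exact h01 _
  have hcard : Fintype.card ((Fin d ⊕ Fin d) ⊕ ((Fin d × Fin d) ⊕ Unit)) + Fintype.card (Fin d × Fin d) =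
      2 * d ^ 2 + 2 * d + 1 := by
    simp only [Fintype.card_sum, Fintype.card_prod, Fintype.card_fin, Fintype.card_unit]
    ring
  rw [← hcard]
  refine isConvGate_of_lp A b B hB f fun v => ?_
  rw [hsem v]
  refine exists_congr fun y => and_congr_right fun _ => ?_
  -- the four kinds of rows, evaluated
  have eA1 : ∀ a, ∑ j, A (Sum.inl (Sum.inl a)) j * y j = ∑ w, y (a, w) := fun a => by
    simp only [A, Sum.elim_inl, boole_mul]
    exact sum_ite_fst_eq y a
  have eA2 : ∀ w, ∑ j, A (Sum.inl (Sum.inr w)) j * y j = ∑ a, y (a, w) := fun w => by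
    simp only [A, Sum.elim_inl, Sum.elim_inr, boole_mul]
    exact sum_ite_snd_eq y w
  have eA3 : ∀ t, ∑ j, A (Sum.inr (Sum.inl t)) j * y j = y t := fun t => by
    simp only [A, Sum.elim_inr, Sum.elim_inl, boole_mul]
    rw [Finset.sum_ite_eq' Finset.univ t]
    simp
  have eA4 : ∀ u, ∑ j, A (Sum.inr (Sum.inr u)) j * y j = -∑ j, y j := fun u => by
    simp only [A, Sum.elim_inr, neg_mul, one_mul, Finset.sum_neg_distrib]
  have eb1 : ∀ a, b (Sum.inl (Sum.inl a)) + ∑ k, B (Sum.inl (Sum.inl a)) k * (if v k then (1 : ℝ) else 0)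
      = 1 := fun a => by simp [b, B]
  have eb2 : ∀ w, b (Sum.inl (Sum.inr w)) + ∑ k, B (Sum.inl (Sum.inr w)) k * (if v k then (1 : ℝ) else 0)
      = 1 := fun w => by simp [b, B]
  have eb3 : ∀ t, b (Sum.inr (Sum.inl t)) + ∑ k, B (Sum.inr (Sum.inl t)) k * (if v k then (1 : ℝ) else 0)
      = act v t := fun t => rfl
  have eb4 : ∀ u, b (Sum.inr (Sum.inr u)) + ∑ k, B (Sum.inr (Sum.inr u)) k * (if v k then (1 : ℝ) else 0)
      = -(θ : ℝ) := fun u => by simp [b, B]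
  constructor
  · rintro ⟨hrow, hcol, hle, hθ⟩
    rintro ((a | w) | (t | u))
    · rw [eA1, eb1]
      exact hrow a
    · rw [eA2, eb2]
      exact hcol w
    · rw [eA3, eb3]
      exact hle t
    · rw [eA4, eb4]
      linarith
  · intro h
    refine ⟨fun a => ?_, fun w => ?_, fun t => ?_, ?_⟩
    · have h' := h (Sum.inl (Sum.inl a))
      rwa [eA1, eb1] at h'
    · have h' := h (Sum.inl (Sum.inr w))
      rwa [eA2, eb2] at h'
    · have h' := h (Sum.inr (Sum.inl t))
      rwa [eA3, eb3] at h'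
    · have h' := h (Sum.inr (Sum.inr ()))
      rw [eA4, eb4] at h'
      linarith

/-- The width of a Hall-cover gate of dimension `d ≤ s` as a CONV gate: `2s² + 2s + 1`. [folklore] -/
theorem isConvGate_of_coverGate_le {n d s θ : ℕ} (hd : d ≤ s) (P₀ : Set (Fin d × Fin d))
    (P : Fin n → Set (Fin d × Fin d)) (f : (Fin n → Bool) → Bool)
    (hf : ∀ v, f v = false ↔ ∃ A W : Finset (Fin d), A.card + W.card < θ ∧
      ∀ x ∈ {x : Fin d × Fin d | x ∈ P₀ ∨ ∃ i, v i = true ∧ x ∈ P i}, x.1 ∈ A ∨ x.2 ∈ W) :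
    IsConvGate (2 * s ^ 2 + 2 * s + 1) ⟨n, f⟩ :=
  (isConvGate_of_coverGate P₀ P f hf).mono (by gcongr)

/-- Exponent bookkeeping: `2 (m^c)² + 2 m^c + 1 ≤ m^(2c+3)` for `m ≥ 2`. [folklore] -/
theorem hallCover_width_le_pow {m c : ℕ} (hm : 2 ≤ m) : 2 * (m ^ c) ^ 2 + 2 * m ^ c + 1 ≤ m ^ (2 * c + 3) := by
  have h1 : 1 ≤ m := by omega
  have hsq : (m ^ c) ^ 2 = m ^ (2 * c) := by rw [← pow_mul]; ring_nf
  have hc : m ^ c ≤ m ^ (2 * c) := Nat.pow_le_pow_right h1 (by omega)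
  have h0 : 1 ≤ m ^ (2 * c) := Nat.one_le_pow _ _ h1
  have h8 : 8 ≤ m ^ 3 := by
    calc 8 = 2 ^ 3 := by norm_num
      _ ≤ m ^ 3 := Nat.pow_le_pow_left hm 3
  calc 2 * (m ^ c) ^ 2 + 2 * m ^ c + 1 ≤ 5 * m ^ (2 * c) := by rw [hsq]; omega
    _ ≤ m ^ 3 * m ^ (2 * c) := Nat.mul_le_mul_right _ (by omega)
    _ = m ^ (2 * c + 3) := by rw [← pow_add]; ring_nf

/-! ### The Hall-cover re-typing of the GRANK half of the crux follows from `ConvexGateBlind` -/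

open scoped Classical in
/-- **`ConvexGateBlind` ⟹ the Hall-cover form of `LinAlgGateBlind`'s GRANK half.** If no polynomial-size
`{∧₂, ∨₂} ∪ CONV_{m^c}` circuit computes `CLIQUE(m, ⌈m^δ⌉₊)` (crux #2, stmt-PneNP-10680), then — same `δ` — no
polynomial-size circuit over `{∧₂, ∨₂}` and HALL-COVER gates of dimension `≤ m^c` (class of the split child
`SGHallCover`, verbatim) computes it: every such gate is a CONV gate of width `≤ m^(2c+3)`. [folklore] -/
theorem hallCoverCircuitBlind_of_convexGateBlind :
    Summit.PneNP.PneNP.Theses.ConvexRankGates.ConvexGateBlind →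
    ∃ δ : ℝ, 0 < δ ∧ δ < 1 / 2 ∧ ∀ c : ℕ, ∀ᶠ m : ℕ in atTop,
      ∀ C : Circuit ((⊤ : SimpleGraph (Fin m)).edgeSet),
        C.IsOver ({GateFn.and 2, GateFn.or 2} ∪ {g : GateFn | ∃ d' θ : ℕ, d' ≤ m ^ c ∧
          ∃ (P₀ : Set (Fin d' × Fin d')) (P : Fin g.1 → Set (Fin d' × Fin d')), ∀ v : Fin g.1 → Bool,
            g.2 v = false ↔ ∃ A W : Finset (Fin d'), A.card + W.card < θ ∧
              ∀ x ∈ {x : Fin d' × Fin d' | x ∈ P₀ ∨ ∃ i, v i = true ∧ x ∈ P i}, x.1 ∈ A ∨ x.2 ∈ W}) →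
        C.size ≤ m ^ c →
        ¬ C.Computes (fun x => decide (¬ (SimpleGraph.fromEdgeSet {e : Sym2 (Fin m) |
            ∃ h : e ∈ (⊤ : SimpleGraph (Fin m)).edgeSet, x ⟨e, h⟩ = true}).CliqueFree ⌈(m : ℝ) ^ δ⌉₊)) := by
  rintro ⟨δ, hδ0, hδ1, hblind⟩
  refine ⟨δ, hδ0, hδ1, fun c => ?_⟩
  filter_upwards [hblind (2 * c + 3), eventually_ge_atTop 2] with m hm h2 C hC hsize
  refine hm C (hC.mono ?_) (hsize.trans (Nat.pow_le_pow_right (by omega) (by omega)))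
  rintro g (hg | hg)
  · exact Or.inl hg
  · obtain ⟨d', θ, hd', P₀, P, hgate⟩ := hg
    obtain ⟨k, f⟩ := g
    exact Or.inr (((isConvGate_of_coverGate P₀ P f hgate).mono (by gcongr)).mono (hallCover_width_le_pow h2))

open scoped Classical in
/-- **`ConvexGateBlind` ⟹ no single Hall-cover gate computes CLIQUE.** For the `δ` of crux #2, every `c`,
eventually in `m`: no Hall-cover gate of dimension `d ≤ m^c` (constant cells `P₀`, cells `P i` owned by wires `w i`
reading edges, threshold `θ`) computes `CLIQUE(m, ⌈m^δ⌉₊)` ("`CLIQUE = 0` iff a vertex cover of size `< θ` covers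
the pattern") — the single-gate floor of the child `SGHallCover`, via `convexGateBlind_iff_oneGate`. [folklore] -/
theorem oneCoverGate_blind_of_convexGateBlind
    (h : Summit.PneNP.PneNP.Theses.ConvexRankGates.ConvexGateBlind) :
    ∃ δ : ℝ, 0 < δ ∧ δ < 1 / 2 ∧ ∀ c : ℕ, ∀ᶠ m : ℕ in atTop, ∀ (d θ : ℕ), d ≤ m ^ c →
      ∀ (P₀ : Set (Fin d × Fin d)) (n : ℕ) (P : Fin n → Set (Fin d × Fin d))
        (w : Fin n → (⊤ : SimpleGraph (Fin m)).edgeSet),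
        ¬ ∀ x : (⊤ : SimpleGraph (Fin m)).edgeSet → Bool,
          (decide (¬ (SimpleGraph.fromEdgeSet {e : Sym2 (Fin m) |
              ∃ h : e ∈ (⊤ : SimpleGraph (Fin m)).edgeSet, x ⟨e, h⟩ = true}).CliqueFree
                ⌈(m : ℝ) ^ δ⌉₊) = false ↔
            ∃ A W : Finset (Fin d), A.card + W.card < θ ∧
              ∀ y ∈ {y : Fin d × Fin d | y ∈ P₀ ∨ ∃ i, x (w i) = true ∧ y ∈ P i}, y.1 ∈ A ∨ y.2 ∈ W) := by
  obtain ⟨δ, hδ0, hδ1, hone⟩ := convexGateBlind_iff_oneGate.1 h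
  refine ⟨δ, hδ0, hδ1, fun c => ?_⟩
  filter_upwards [hone (2 * c + 3), eventually_ge_atTop 2] with m hm h2 d θ hd P₀ n P w hcomp
  -- the cover gate, as a `GateFn` of arity `n`
  let Q : (Fin n → Bool) → Prop := fun v => ∃ A W : Finset (Fin d), A.card + W.card < θ ∧
    ∀ y ∈ {y : Fin d × Fin d | y ∈ P₀ ∨ ∃ i, v i = true ∧ y ∈ P i}, y.1 ∈ A ∨ y.2 ∈ W
  let g : GateFn := ⟨n, fun v => decide (¬ Q v)⟩
  have hgQ : ∀ v, g.2 v = false ↔ Q v := fun v => by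
    change decide (¬ Q v) = false ↔ Q v
    rw [decide_eq_false_iff_not, not_not]
  have hconv : IsConvGate (m ^ (2 * c + 3)) g :=
    ((isConvGate_of_coverGate P₀ P g.2 hgQ).mono (by gcongr)).mono (hallCover_width_le_pow h2)
  refine hm g hconv w fun x => ?_
  -- `g (x ∘ w) = CLIQUE(x)`: two Booleans with the same `= false` condition agree
  have key : g.2 (fun a => x (w a)) = false ↔
      decide (¬ (SimpleGraph.fromEdgeSet {e : Sym2 (Fin m) |
        ∃ h : e ∈ (⊤ : SimpleGraph (Fin m)).edgeSet, x ⟨e, h⟩ = true}).CliqueFree ⌈(m : ℝ) ^ δ⌉₊) = false :=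
    (hgQ _).trans (hcomp x).symm
  revert key
  cases g.2 (fun a => x (w a)) <;>
    cases decide (¬ (SimpleGraph.fromEdgeSet {e : Sym2 (Fin m) |
      ∃ h : e ∈ (⊤ : SimpleGraph (Fin m)).edgeSet, x ⟨e, h⟩ = true}).CliqueFree ⌈(m : ℝ) ^ δ⌉₊) <;> simp

end Summit.PneNP.PneNP.Theorems

end
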